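import Summits.BirchSwinnertonDyer.Rank1Residual.Additive.X4TamDefectLevelLoweringFromWilesIrreducible
import Summits.BirchSwinnertonDyer.Rank1Residual.X4.OldEigenSymbOfIhara
import HarnessLib

/-!
# TAM-DEFECT₂ on the twist-good locus with BOTH printed inputs BY NAME: multiplicity one (DDT Thm. 4.26) AND Ihara's lemma (Ribet 1984 Thm. 4.1) (cell `b2b-bsdres`, seat additive-p4, line V44)

HONEST FRAMING (verbatim, cell `b2b-bsdres`): the goal of the cell is to DELETE the COMBINATION-SHAPED
residual classes for ALL analytic-rank `≤ 1` curves over `ℚ` — "full BSD formula for every rank `≤ 1`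
curve in class `C`" assembled STRICTLY from published theorems — so that the rank-`≤ 1` remainder
becomes exactly the CONSTRUCTION-SHAPED classes, which are TYPED (missing-input Props), NOT attempted;
this is not "finishing BSD". This file: TOOL theorems, 0 defs, 0 facts, nothing booked; X4
CONSTRUCTION-SHAPED. The ENDs of the V42 class theorem (TAM-DEFECT₂ unit rows on the twist-good locus,
`p ≥ 5`) with the two printed inputs of Ribet's level-lowering mechanism consumed BY NAME from the
tree's Literature: `wiles1995_multiplicityOne` (cc-typer-1 p317688, DDT Thm. 4.26 AS PRINTED) for
(MO), and `ribet1984_iharaLemma` (cc-typer-1 p318719, DDT Lemma 4.28 (a) + 4.30 (b) / Diamond–Ribet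
§4.4 AS PRINTED) for the non-vanishing half of (OLD).

## What the END now displays (even twists `d > 0`; odd twists alike with the minus objects)

`X4.bsdp_of_wiles1995_ihara_quadraticTwist_of_pos_of_five_le`: **`BSD(E,p)`** for `E = C • W₀^{(d)}`
on the twist-good locus from
* PUBLISHED named facts BY NAME: `wiles1995_multiplicityOne`, `ribet1984_iharaLemma`, Kim 2026
  Thm. 1.8 (6) (two halves), Cassels–Tate, GZK, modularity;
* two Summits-side TARGETS (assert nothing): the repaired Eichler–Shimura dictionary node
  `EichlerShimuraModPMultiplicityOneOfIrreducible` (gen 25 K46) at `(Mℓ, p, χ₀, θ̄_{W₀})`, and —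
  displayed as DATA, not as a `Prop` — the LEVEL-`M` EIGEN DATUM of Ribet's level-lowered form:
  a `1`-periodic even `μ : ℚ → k` with symbol in `Symb_{Γ₀(M)}(k)`, Hecke-eigen with system `θ`
  (`T_q` off `M`, `U_q` on `M`), `θ = θ̄_{W₀}` off `ℓ`, the `ℓ`-stabilisation root relation
  `θ̄(ℓ)² − θ(ℓ) θ̄(ℓ) + ℓ = 0`, `w θ̄(ℓ) = 1`, and its carrying `𝕋̃`-eigen functional `Λ` on
  `H₁(X₀(M), ℤ)` (character `χ`, kernel maximal and non-Eisenstein, `Λ ≠ 0` on a cycle) — the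
  reduced symbol of the form `g` of Ribet 1990 Thm. 1.1 / `diamond1995_refinedSerre`; EXISTENCE of this
  datum is the lane's node (T2′), NOT supplied here;
* per-row numerals: r_an `= 0`, `ρ̄_{E,p}` onto, conductor-level datum with `p ∤ c_D` and the period
  transfer, `#Ш_an` a `p`-unit, `ord_p ∏c ≤ 2`, the geometric twist datum, the mod-`p` eigencharacter
  `χ₀` of `W₀` with the printed hypotheses of DDT Thm. 4.26 and its Galois package, the Tamagawa prime
  `ℓ ∥` with `ℓ ∤ M d`, the transport sign `w χ_d(ℓ) = 1`.
The Hecke relation of `μ` at the Kolyvagin primes (gen 23's binder `hH`) is now DERIVED from the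
level-`M` relations (`q ∤ N ⊇ Mℓ`). `(2 : k) ≠ 0` is derived from `p ≥ 5` along `ι : 𝔽_p → k`.

## References

* H. Darmon, F. Diamond, R. Taylor, *Fermat's Last Theorem* (1995), Thm. 4.26, Lemma 4.28 (a), Lemma 4.30, §4.5. [cite: DarmonDiamondTaylor1995, Thm. 4.26 (§4.5, p. 134) and Lemma 4.28 (a) (p. 135)]
* K. A. Ribet, Proc. ICM 1983 (1984), Thm. 4.1; Invent. Math. 100 (1990), Thm. 1.1, Thm. 5.2 (b). [cite: Ribet1984ICM, Thm. 4.1] [cite: Ribet1990, Thm. 1.1 and Thm. 5.2 (b)]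
* C.-H. Kim, Amer. J. Math. 148 (2026) = arXiv:2203.12159, Thm. 1.9 (6), Conj. 1.10. [cite: Kim2022StructureSelmer, Thm. 1.9 (6) and Conj. 1.10 (PDF p. 8)]
* J. H. Silverman, *The Arithmetic of Elliptic Curves* (2009), Thm. X.4.14. [cite: SilvermanAEC2009, Thm. X.4.14]
-/

noncomputable section

open scoped MatrixGroups ModularForm NumberTheorySymbols NumberField

open CongruenceSubgroup Finset IsDedekindDomain Polynomial

open Literature.NumberTheory.EllipticCurves Literature.NumberTheory.EllipticCurves.ModularForms
  Literature.NumberTheory.EllipticCurves.ModularForms.HidaCohomology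

namespace Summit.BirchSwinnertonDyer.Rank1Residual.X4

open Complex WeierstrassCurve Literature.NumberTheory.EllipticCurves.Rank1Residual
  Literature.NumberTheory.EllipticCurves.Rank1Residual.Typed
  Summit.BirchSwinnertonDyer.Rank1Residual.Additive
  Summit.BirchSwinnertonDyer.Rank1Residual.LevelLowering
  Literature.NumberTheory.GaloisRepresentations Rat.HeightOneSpectrum

variable {k : Type*} [CommRing k] [Nontrivial k]
  (W₀ W : WeierstrassCurve ℚ) [W₀.IsElliptic] [W₀.IsGloballyMinimal] [W.IsElliptic] [W.IsGloballyMinimal]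
  (p : ℕ) [hp5 : Fact p.Prime] (ι : ZMod p →+* k)

include ι in
/-- `(2 : k) ≠ 0` along `ι : 𝔽_p → k` for `p ≥ 5` (indeed `p ≠ 2`). [folklore] -/
theorem two_ne_zero_of_five_le (hp : 5 ≤ p) : (2 : k) ≠ 0 := by
  rw [show (2 : k) = ι 2 from (map_ofNat ι 2).symm, map_ne_zero ι,
    show (2 : ZMod p) = ((2 : ℕ) : ZMod p) by norm_cast, Ne, ZMod.natCast_eq_zero_iff]
  intro hd
  have := Nat.le_of_dvd two_pos hd
  omega

omit [Nontrivial k] [W.IsElliptic] hp5 in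
/-- The Hecke relation of the level-`M` function `μ` at every Kolyvagin prime `q` of `W` (`q ∤ N_W`,
so `q ∤ M` and `q ≠ ℓ` when `M ℓ ∣ N_W ∋ ℓ`), from its `T_q`-relations off `M` with system `θ` and
`θ = θ̄` off `ℓ`. [folklore] -/
theorem heckeRel_of_isKolyvaginPrime_of_level {M ℓ N : ℕ} {μ : ℚ → k} {θ θ' : ℕ → k}
    (hN : W.conductorNorm ℤ = N) (hN₀ : M * ℓ ∣ N) (hℓN : ℓ ∣ W.conductorNorm ℤ)
    (hT : ∀ q : ℕ, q.Prime → ¬ q ∣ M → HeckeRel μ q (θ q))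
    (hθ : ∀ q : ℕ, q ≠ ℓ → θ' q = θ q) {q : ℕ} (hq : Kato.IsKolyvaginPrime W p 1 q) :
    HeckeRel μ q (θ' q) := by
  have hqN : ¬ q ∣ W.conductorNorm ℤ := hq.not_dvd_conductorNorm
  have hqM : ¬ q ∣ M := fun h ↦ hqN (by rw [hN]; exact (h.mul_right ℓ).trans hN₀)
  have hqℓ : q ≠ ℓ := fun h ↦ hqN (h ▸ hℓN)
  rw [hθ q hqℓ]
  exact hT q hq.prime hqM

/-- **TAM-DEFECT₂ ON THE TWIST-GOOD LOCUS, even twists `d > 0`, `p ≥ 5` — MULTIPLICITY ONE AND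
IHARA'S LEMMA BOTH BY NAME.** `BSD(E,p)` for `E = C • W₀^{(d)}` (r_an `= 0`, `ρ̄_{E,p}` onto,
conductor-level datum with `p ∤ c_D` and period transfer, `#Ш_an` unit, `ord_p ∏c ≤ 2`) from:
`wiles1995_multiplicityOne` (DDT Thm. 4.26) + the repaired dictionary target
`EichlerShimuraModPMultiplicityOneOfIrreducible` at the twist partner's level `Mℓ` ⟹ (MO);
`ribet1984_iharaLemma` (Ribet 1984 Thm. 4.1 / DDT L.4.28 (a) + 4.30 (b)) + the LEVEL-`M` EIGEN DATUM
`(μ, θ, Λ, χ)` of Ribet's level-lowered form at the Tamagawa prime `ℓ` (displayed; existence =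
Ribet 1990 Thm. 1.1, NOT supplied) + the root/sign numerals ⟹ (OLD) (gen 23 K9 + gen 25 K47); then
gen 23's chain: Kim 2026 Thm. 1.8 (6), Cassels–Tate, GZK, modularity (PUBLISHED) ⟹ **`BSD(E,p)`**.
Nothing booked. [cite: DarmonDiamondTaylor1995, Thm. 4.26 (§4.5, p. 134) and Lemma 4.28 (a) (p. 135)]
[cite: Ribet1984ICM, Thm. 4.1] [cite: Ribet1990, Thm. 1.1 and Thm. 5.2 (b)]
[cite: Kim2022StructureSelmer, Thm. 1.9 (6) and Conj. 1.10 (PDF p. 8)] [cite: SilvermanAEC2009, Thm. X.4.14] -/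
theorem bsdp_of_wiles1995_ihara_quadraticTwist_of_pos_of_five_le
    (hW1 : wiles1995_multiplicityOne) (hI : ribet1984_iharaLemma)
    (hKimk : Kim2026.rankZero_le_padicValNat_sha_of_kuriharaNumber_ne_zero)
    (hE67c : Kim2026.rankZero_padicValNat_sha_add_le_of_forall_pow_dvd_kuriharaNumber_cyclicLevel)
    (hCT : exists_casselsTate_pairing (K := ℚ))
    (hGZK : rank_eq_analyticRank_of_analyticRank_le_one) (hmod : hasEntireLFunction_rat)
    (hp : 5 ≤ p) (hr : W.analyticRank = 0) (hsurj : W.HasSurjectiveModNGaloisRep p)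
    {N : ℕ} [NeZero N] (D : ModularParametrizationData W N) (hN : W.conductorNorm ℤ = N)
    (hc : ¬ (p : ℤ) ∣ D.maninConstant)
    (hper : ∃ u : ℚ, ‖(u : ℚ_[p])‖ = 1 ∧ W.realPeriodRat = u * plusPeriod D.f)
    {q' : ℚ} (hq' : shaAn W = (q' : ℂ)) (hv : padicValRat p q' = 0)
    (hc2 : padicValNat p W.tamagawaProduct ≤ 2)
    -- the geometric twist datum
    {d : ℤ} (hd4 : d % 4 = 1) (hsq : Squarefree d) (hd : 0 < d) (C : VariableChange ℚ)
    (hC : C • W₀.quadraticTwist (d : ℚ) = W)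
    (hgm : ∀ v : HeightOneSpectrum (𝓞 ℚ), ((Rat.HeightOneSpectrum.primesEquiv v : ℕ) : ℤ) ∣ d →
      W₀.HasGoodReductionAt v ∨ W₀.HasMultiplicativeReductionAt v)
    -- the twist partner's newform at level `M ℓ`, `ℓ` the Tamagawa prime, `ℓ ∤ M`
    {M : ℕ} [NeZero M] {ℓ : ℕ} [Fact ℓ.Prime] [NeZero (M * ℓ)] (hℓM : ¬ ℓ ∣ M) [NeZero d.natAbs]
    {f₀ : CuspForm (Gamma0 (M * ℓ)) 2} (hf₀ : IsNewformOf W₀ f₀)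
    (hN₀ : M * ℓ ∣ N) (hm : d.natAbs ^ 2 ∣ N) (hmN : d.natAbs ∣ W.conductorNorm ℤ)
    (hper₀ : ∃ u : ℚ, ‖(u : ℚ_[p])‖ = 1 ∧ W₀.realPeriodRat = u * plusPeriod f₀)
    (hirr₀ : W₀.HasIrreducibleModPGaloisRep p)
    (hℓN : ℓ ∣ W.conductorNorm ℤ) (hℓ : ℓ.Coprime d.natAbs)
    -- (MO) from print: eigencharacter, DDT Thm. 4.26 hypotheses + Galois package, repaired dictionary
    (χ₀ : HeckeRing0 (M * ℓ) 2 →+* k)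
    (hχ₀ : ∀ (q : ℕ) (hq : q.Prime),
      χ₀ (HeckeRing0.T (M * ℓ) 2 q hq) = ι ((W₀.LFunction q : ℤ) : ZMod p))
    (hp𝔪 : (p : HeckeRing0 (M * ℓ) 2) ∈ RingHom.ker χ₀) (h𝔪 : (RingHom.ker χ₀).IsMaximal)
    (hpN₀ : ¬ p ∣ M * ℓ ∨ (¬ p ^ 2 ∣ M * ℓ ∧ HeckeRing0.T (M * ℓ) 2 p hp5.out ∉ RingHom.ker χ₀))
    (k' : Type) [Field k'] [TopologicalSpace k'] [DiscreteTopology k']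
    (ι' : HeckeRing0 (M * ℓ) 2 ⧸ RingHom.ker χ₀ →+* k') (ρ : ModPGaloisRep ℚ k' 2)
    (hρ : ∀ v : HeightOneSpectrum (𝓞 ℚ), ¬ ((primesEquiv v : Nat.Primes) : ℕ) ∣ M * ℓ * p →
        ρ.IsUnramifiedAt v ∧
          ρ.HasFrobCharpolyAt v
            (X ^ 2
              - Polynomial.C (ι' (Ideal.Quotient.mk (RingHom.ker χ₀) (HeckeRing0.T (M * ℓ) 2
                  ((primesEquiv v : Nat.Primes) : ℕ) (primesEquiv v : Nat.Primes).2))) * X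
              + Polynomial.C (((primesEquiv v : Nat.Primes) : ℕ) : k')))
    (hρirr : FramedRep.IsIrreducible ρ)
    (hES : EichlerShimuraModPMultiplicityOneOfIrreducible (M * ℓ) p χ₀
      (fun q ↦ ι ((W₀.LFunction q : ℤ) : ZMod p)))
    -- (OLD) from print: the LEVEL-`M` eigen datum of Ribet's form + Ihara BY NAME + numerals
    {μ : ℚ → k} (hμ : IsPeriodic μ) (heven : ∀ r : ℚ, μ (-r) = μ r)
    (hΓ : potSymbOf μ ∈ (CoeffActionOn.symPowOn (sigma0Set M) 0 k).Symb (Gamma0 M))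
    (θ : ℕ → k) (hT : ∀ q : ℕ, q.Prime → ¬ q ∣ M → HeckeRel μ q (θ q))
    (hU : ∀ q : ℕ, q.Prime → q ∣ M → ∀ r : ℚ, ∑ j ∈ Finset.range q, μ ((r + j) / q) = θ q * μ r)
    (hθ : ∀ q : ℕ, q ≠ ℓ → ι ((W₀.LFunction q : ℤ) : ZMod p) = θ q)
    {w : k}
    (hα : ι ((W₀.LFunction ℓ : ℤ) : ZMod p) ^ 2 - θ ℓ * ι ((W₀.LFunction ℓ : ℤ) : ZMod p) + ℓ = 0)
    (hwα : w * ι ((W₀.LFunction ℓ : ℤ) : ZMod p) = 1)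
    (Λ : Module.Dual ℂ (CuspForm (Gamma0 M) 2) → k)
    (χ : HeckeRing0.primeTo M 2 (M * ℓ) →+* k)
    (hΛ : ∀ (s : HeckeRing0.primeTo M 2 (M * ℓ)), ∀ x ∈ periodHomology M,
      Λ ((s : HeckeRing0 M 2) • x) = χ s * Λ x)
    (h𝔫 : (RingHom.ker χ).IsMaximal) (hE : ¬ HeckeRing0.primeTo.IsEisenstein (RingHom.ker χ))
    {x : Module.Dual ℂ (CuspForm (Gamma0 M) 2)} (hx : x ∈ periodHomology M) (hΛx : Λ x ≠ 0)
    (hμΛ : ∀ y ∈ periodHomology M, ∀ r : ℚ,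
      (∀ f : CuspForm (Gamma0 M) 2, y f = modularSymbol f r) → μ r = Λ y)
    (hw : w * ι ((J((ℓ : ℤ) | d.natAbs) : ℤ) : ZMod p) = 1) : BSDp W p := by
  -- (OLD) at level `Mℓ` from the level-`M` datum + Ihara's lemma BY NAME (K9 + K47)
  have hOLD : HasOldEigenPlusSymb k (M * ℓ) (fun q ↦ ι ((W₀.LFunction q : ℤ) : ZMod p)) ℓ w μ :=
    hasOldEigenPlusSymb_of_ribet1984_iharaLemma hI hμ heven hΓ θ hT hU hℓM hα hwα
      (fun q ↦ ι ((W₀.LFunction q : ℤ) : ZMod p)) hθ rfl Λ χ hΛ h𝔫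
      (two_ne_zero_of_five_le p ι hp) hE hx hΛx hμΛ
  -- the Hecke relation at the Kolyvagin primes is the level-`M` one
  have hH : ∀ q : ℕ, Kato.IsKolyvaginPrime W p 1 q →
      HeckeRel μ q (ι ((W₀.LFunction q : ℤ) : ZMod p)) := fun q hq ↦
    heckeRel_of_isKolyvaginPrime_of_level W p hN hN₀ hℓN hT hθ hq
  exact bsdp_of_wiles1995_irreducible_quadraticTwist_of_pos_of_five_le W₀ W p ι hW1 hKimk hE67c hCT
    hGZK hmod hp hr hsurj D hN hc hper hq' hv hc2 hd4 hsq hd C hC hgm hf₀ hN₀ hm hmN hper₀ hirr₀ χ₀ hχ₀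
    hp𝔪 h𝔪 hpN₀ k' ι' ρ hρ hρirr hES hℓN hℓ hOLD hμ hH hw

/-- **TAM-DEFECT₂ ON THE TWIST-GOOD LOCUS, odd twists `d < 0`, `p ≥ 5` — MULTIPLICITY ONE AND
IHARA'S LEMMA BOTH BY NAME (minus objects).** As
`bsdp_of_wiles1995_ihara_quadraticTwist_of_pos_of_five_le` with the MINUS dictionary target
`EichlerShimuraModPMultiplicityOneMinusOfIrreducible`, an ODD level-`M` datum `μ`, the imaginary
period transfer and the minus-symbol integrality numeral; (OLD⁻) from K9 + K47 with
`ribet1984_iharaLemma` BY NAME; then gen 23's K6 chain ⟹ **`BSD(E,p)`**. Nothing booked.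
[cite: DarmonDiamondTaylor1995, Thm. 4.26 (§4.5, p. 134) and Lemma 4.28 (a) (p. 135)]
[cite: Ribet1984ICM, Thm. 4.1] [cite: Ribet1990, Thm. 1.1 and Thm. 5.2 (b)]
[cite: Kim2022StructureSelmer, Thm. 1.9 (6) and Conj. 1.10 (PDF p. 8)] [cite: SilvermanAEC2009, Thm. X.4.14] -/
theorem bsdp_of_wiles1995_ihara_quadraticTwist_of_neg_of_five_le
    (hW1 : wiles1995_multiplicityOne) (hI : ribet1984_iharaLemma)
    (hKimk : Kim2026.rankZero_le_padicValNat_sha_of_kuriharaNumber_ne_zero)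
    (hE67c : Kim2026.rankZero_padicValNat_sha_add_le_of_forall_pow_dvd_kuriharaNumber_cyclicLevel)
    (hCT : exists_casselsTate_pairing (K := ℚ))
    (hGZK : rank_eq_analyticRank_of_analyticRank_le_one) (hmod : hasEntireLFunction_rat)
    (hp : 5 ≤ p) (hr : W.analyticRank = 0) (hsurj : W.HasSurjectiveModNGaloisRep p)
    {N : ℕ} [NeZero N] (D : ModularParametrizationData W N) (hN : W.conductorNorm ℤ = N)
    (hc : ¬ (p : ℤ) ∣ D.maninConstant)
    (hper : ∃ u : ℚ, ‖(u : ℚ_[p])‖ = 1 ∧ W.realPeriodRat = u * plusPeriod D.f)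
    {q' : ℚ} (hq' : shaAn W = (q' : ℂ)) (hv : padicValRat p q' = 0)
    (hc2 : padicValNat p W.tamagawaProduct ≤ 2)
    {d : ℤ} (hd4 : d % 4 = 1) (hsq : Squarefree d) (hd : d < 0) (C : VariableChange ℚ)
    (hC : C • W₀.quadraticTwist (d : ℚ) = W)
    (hgm : ∀ v : HeightOneSpectrum (𝓞 ℚ), ((Rat.HeightOneSpectrum.primesEquiv v : ℕ) : ℤ) ∣ d →
      W₀.HasGoodReductionAt v ∨ W₀.HasMultiplicativeReductionAt v)
    {M : ℕ} [NeZero M] {ℓ : ℕ} [Fact ℓ.Prime] [NeZero (M * ℓ)] (hℓM : ¬ ℓ ∣ M) [NeZero d.natAbs]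
    {f₀ : CuspForm (Gamma0 (M * ℓ)) 2} (hf₀ : IsNewformOf W₀ f₀)
    (hN₀ : M * ℓ ∣ N) (hm : d.natAbs ^ 2 ∣ N) (hmN : d.natAbs ∣ W.conductorNorm ℤ)
    (hper₀ : ∃ u : ℚ, ‖(u : ℚ_[p])‖ = 1 ∧ W₀.imaginaryPeriodRat = u * minusPeriod f₀)
    (hint : ∀ x : ℚ, ¬ p ∣ (ratMinusSymbol f₀ x).den)
    (hℓN : ℓ ∣ W.conductorNorm ℤ) (hℓ : ℓ.Coprime d.natAbs)
    -- (MO⁻) from print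
    (χ₀ : HeckeRing0 (M * ℓ) 2 →+* k)
    (hχ₀ : ∀ (q : ℕ) (hq : q.Prime),
      χ₀ (HeckeRing0.T (M * ℓ) 2 q hq) = ι ((W₀.LFunction q : ℤ) : ZMod p))
    (hp𝔪 : (p : HeckeRing0 (M * ℓ) 2) ∈ RingHom.ker χ₀) (h𝔪 : (RingHom.ker χ₀).IsMaximal)
    (hpN₀ : ¬ p ∣ M * ℓ ∨ (¬ p ^ 2 ∣ M * ℓ ∧ HeckeRing0.T (M * ℓ) 2 p hp5.out ∉ RingHom.ker χ₀))
    (k' : Type) [Field k'] [TopologicalSpace k'] [DiscreteTopology k']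
    (ι' : HeckeRing0 (M * ℓ) 2 ⧸ RingHom.ker χ₀ →+* k') (ρ : ModPGaloisRep ℚ k' 2)
    (hρ : ∀ v : HeightOneSpectrum (𝓞 ℚ), ¬ ((primesEquiv v : Nat.Primes) : ℕ) ∣ M * ℓ * p →
        ρ.IsUnramifiedAt v ∧
          ρ.HasFrobCharpolyAt v
            (X ^ 2
              - Polynomial.C (ι' (Ideal.Quotient.mk (RingHom.ker χ₀) (HeckeRing0.T (M * ℓ) 2
                  ((primesEquiv v : Nat.Primes) : ℕ) (primesEquiv v : Nat.Primes).2))) * X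
              + Polynomial.C (((primesEquiv v : Nat.Primes) : ℕ) : k')))
    (hρirr : FramedRep.IsIrreducible ρ)
    (hES : EichlerShimuraModPMultiplicityOneMinusOfIrreducible (M * ℓ) p χ₀
      (fun q ↦ ι ((W₀.LFunction q : ℤ) : ZMod p)))
    -- (OLD⁻) from print: the odd LEVEL-`M` eigen datum + Ihara BY NAME + numerals
    {μ : ℚ → k} (hμ : IsPeriodic μ) (hodd : ∀ r : ℚ, μ (-r) = -μ r)
    (hΓ : potSymbOf μ ∈ (CoeffActionOn.symPowOn (sigma0Set M) 0 k).Symb (Gamma0 M))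
    (θ : ℕ → k) (hT : ∀ q : ℕ, q.Prime → ¬ q ∣ M → HeckeRel μ q (θ q))
    (hU : ∀ q : ℕ, q.Prime → q ∣ M → ∀ r : ℚ, ∑ j ∈ Finset.range q, μ ((r + j) / q) = θ q * μ r)
    (hθ : ∀ q : ℕ, q ≠ ℓ → ι ((W₀.LFunction q : ℤ) : ZMod p) = θ q)
    {w : k}
    (hα : ι ((W₀.LFunction ℓ : ℤ) : ZMod p) ^ 2 - θ ℓ * ι ((W₀.LFunction ℓ : ℤ) : ZMod p) + ℓ = 0)
    (hwα : w * ι ((W₀.LFunction ℓ : ℤ) : ZMod p) = 1)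
    (Λ : Module.Dual ℂ (CuspForm (Gamma0 M) 2) → k)
    (χ : HeckeRing0.primeTo M 2 (M * ℓ) →+* k)
    (hΛ : ∀ (s : HeckeRing0.primeTo M 2 (M * ℓ)), ∀ x ∈ periodHomology M,
      Λ ((s : HeckeRing0 M 2) • x) = χ s * Λ x)
    (h𝔫 : (RingHom.ker χ).IsMaximal) (hE : ¬ HeckeRing0.primeTo.IsEisenstein (RingHom.ker χ))
    {x : Module.Dual ℂ (CuspForm (Gamma0 M) 2)} (hx : x ∈ periodHomology M) (hΛx : Λ x ≠ 0)
    (hμΛ : ∀ y ∈ periodHomology M, ∀ r : ℚ,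
      (∀ f : CuspForm (Gamma0 M) 2, y f = modularSymbol f r) → μ r = Λ y)
    (hw : w * ι ((J((ℓ : ℤ) | d.natAbs) : ℤ) : ZMod p) = 1) : BSDp W p := by
  have hOLD : HasOldEigenMinusSymb k (M * ℓ) (fun q ↦ ι ((W₀.LFunction q : ℤ) : ZMod p)) ℓ w μ :=
    hasOldEigenMinusSymb_of_ribet1984_iharaLemma hI hμ hodd hΓ θ hT hU hℓM hα hwα
      (fun q ↦ ι ((W₀.LFunction q : ℤ) : ZMod p)) hθ rfl Λ χ hΛ h𝔫
      (two_ne_zero_of_five_le p ι hp) hE hx hΛx hμΛ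
  have hH : ∀ q : ℕ, Kato.IsKolyvaginPrime W p 1 q →
      HeckeRel μ q (ι ((W₀.LFunction q : ℤ) : ZMod p)) := fun q hq ↦
    heckeRel_of_isKolyvaginPrime_of_level W p hN hN₀ hℓN hT hθ hq
  exact bsdp_of_wiles1995_irreducible_quadraticTwist_of_neg_of_five_le W₀ W p ι hW1 hKimk hE67c hCT
    hGZK hmod hp hr hsurj D hN hc hper hq' hv hc2 hd4 hsq hd C hC hgm hf₀ hN₀ hm hmN hper₀ hint χ₀ hχ₀
    hp𝔪 h𝔪 hpN₀ k' ι' ρ hρ hρirr hES hℓN hℓ hOLD hμ hH hw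

end Summit.BirchSwinnertonDyer.Rank1Residual.X4

end
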